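import Literature.Analysis.FluidPDE.FluidComputer.ThresholdDrainGluing
import HarnessLib

/-!
# Fluid computer blueprint — threshold gate: the LEVEL-SET RUNGS of the transfer stage

HONEST FRAMING: low prior, high value-of-information experiment on Tao's machine paradigm; NOT a
claim that NS blows up. Elementary one-sided comparison for the 5-mode circuit
`thresholdCircuit ε σ ν μ r κ` (`ThresholdGate.lean`) on a forced window (`IsForcedWindow`,
right derivative within `δ` of the field); nothing is asserted about any fluid equation.

## What this file is (bp3 gen 12)

`ThresholdTransferNecessary.lean` shows that the hypotheses of the landed stage-3 theorem
`exists_output_loaded` force `64νμ² < εr²`, which no rung of the design ladder satisfies. The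
repair identified numerically (interval bookkeeping `bookkeep.py` v5 / `bookkeep_v6.py`, data
`pub-fluidc/data/thgate/bookkeep-g11,g12`) is a **level-set re-typing**: the transfer is cut into
sub-windows delimited by LEVELS of the (monotone) trigger `c`, and on each sub-window every mode is
enclosed by one-sided comparison from a BOX valid on the sub-window. This file lands the comparison
lemmas ("rungs") in exactly the form the per-level step consumes (`ThresholdLevelStep`, to follow):

* `slavingResidual κ r X = κ·d·ã - r·c·a` — the conduit measured against its slaved value. Along
  the circuit `∂ₜw = -κã·w + Ψ(X) + forcing` with the POLYNOMIAL source
  `Ψ = κ²d³ - rσa³ - r(νb - μa)ac + rεabc + rσac² - rμc³ + r²c²d`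
  (`hasDerivWithinAt_slavingResidual`, `slavingResidual_deriv_eq`); hence the exponential
  relaxation floor / ceiling `slavingResidual_ge` / `slavingResidual_le` (rates `κZh`, `κZℓ`, the
  source bounded monomial-wise on the box). The frozen-target form of the conduit floor
  (`ThresholdTransferAngle.conduit_floor` iterated per level) is numerically useless (the carrier
  box feeds back into its own decay rate; `bookkeep_v6.py` form `abs` dies at 0.74E); the residual
  form certifies `≥ 0.90E` on every design of the ladder with `κ ≥ 20·r·c_eq`.
* `carrier_ge_gronwall` / `carrier_le_gronwall` — the carrier obeys the LINEAR comparisons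
  `∂ₜa ≥ -(εBh + σch + L)a + (μcℓ² - M - δ)` and `∂ₜa ≤ -(εBℓ + σcℓ + L')a + (μch² + M' + δ)` once
  the rotor term is bounded `L'a - M' ≤ r·d·c ≤ La + M`; and `rotor_le_of_slavingResidual` /
  `rotor_ge_of_slavingResidual` supply exactly such bounds from the residual box with
  `L = r²ch²/(κZℓ)` — NO dependence on the carrier box (this is what makes the bookkeeping close).
* `trigger_ge_lin` / `trigger_le_lin`, `clock_ge_lin` / `clock_le_lin`, `output_le_lin` /
  `output_ge_lin` — affine two-sided bounds of trigger, clock and output from the box;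
  `conduit_le_lin`, `conduit_ge_gronwall`, `trigger_ge_gronwall` — the CRUDE (ball-only) bounds of
  the first pass; `conduit_bounds_of_slavingResidual` — the conduit box from the residual box.

All conclusions are stated with Mathlib's `gronwallBound` (so that the degenerate rate `0` needs
no separate statement). [cite: Tao2016AveragedNS, §5.5 Thm 5.3 (5.5)] for the circuit; every lemma
here is [folklore] calculus.
-/

noncomputable section

open Set Filter Topology
open scoped NNReal

namespace Literature.Analysis.FluidPDE.FluidComputer

open Literature.Analysis.FluidPDE.Tao2016AveragedNS Literature.Analysis.ODE

variable {ε σ ν μ r κ δ τ : ℝ} {x : ℝ → Fin 5 → ℝ}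

/-- The **slaving residual** of the conduit: `w = κ·d·ã - r·c·a` (zero exactly when the rotor feed
`rca` balances the drain `κdã`). [folklore] -/
def slavingResidual (κ r : ℝ) (X : Fin 5 → ℝ) : ℝ := κ * X 3 * X 4 - r * X 2 * X 0

/-- The polynomial source in the residual's equation `∂ₜw = -κã·w + Ψ`. [folklore] -/
def slavingSource (ε σ ν μ r κ : ℝ) (X : Fin 5 → ℝ) : ℝ :=
  κ ^ 2 * X 3 ^ 3 - r * σ * X 0 ^ 3 - r * (ν * X 1 - μ * X 0) * X 0 * X 2 +
    r * ε * X 0 * X 1 * X 2 + r * σ * X 0 * X 2 ^ 2 - r * μ * X 2 ^ 3 + r ^ 2 * X 2 ^ 2 * X 3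

/-- Unfolding the residual. [folklore] -/
@[simp] theorem slavingResidual_apply (κ r : ℝ) (X : Fin 5 → ℝ) :
    slavingResidual κ r X = κ * X 3 * X 4 - r * X 2 * X 0 := rfl

/-- **The residual equation along the exact field**: `Dw·F = -κã·w + Ψ`. [folklore] -/
theorem slavingResidual_deriv_eq (ε σ ν μ r κ : ℝ) (X : Fin 5 → ℝ) :
    κ * (thresholdCircuit ε σ ν μ r κ X 3 * X 4 + X 3 * thresholdCircuit ε σ ν μ r κ X 4) -
        r * (thresholdCircuit ε σ ν μ r κ X 2 * X 0 + X 2 * thresholdCircuit ε σ ν μ r κ X 0) =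
      -(κ * X 4) * slavingResidual κ r X + slavingSource ε σ ν μ r κ X := by
  simp only [thresholdCircuit_apply_zero, thresholdCircuit_apply_two,
    thresholdCircuit_apply_three, thresholdCircuit_apply_four, slavingResidual, slavingSource]
  ring


/-! ### Calculus of the comparison envelopes -/

/-- The derivative of Mathlib's `gronwallBound δ K ε` at `x` is `(Kδ + ε)e^{Kx}`. [folklore] -/
theorem gronwallBound_deriv_eq (δ K ε x : ℝ) :
    K * gronwallBound δ K ε x + ε = (K * δ + ε) * Real.exp (K * x) := by
  by_cases hK : K = 0
  · subst hK; simp [gronwallBound_K0]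
  · rw [gronwallBound_of_K_ne_0 hK]; field_simp; ring

/-- **Endpoint bracketing.** `t ↦ gronwallBound δ K ε t` is monotone on `ℝ` (its derivative
`(Kδ + ε)e^{Kt}` has constant sign), so on a time interval it lies between its endpoint values.
This is how a time-dependent comparison envelope becomes a BOX on a sub-window. [folklore] -/
theorem gronwallBound_mem_endpoints (δ K ε : ℝ) {t₁ t₂ t : ℝ} (ht : t ∈ Icc t₁ t₂) :
    min (gronwallBound δ K ε t₁) (gronwallBound δ K ε t₂) ≤ gronwallBound δ K ε t ∧
      gronwallBound δ K ε t ≤ max (gronwallBound δ K ε t₁) (gronwallBound δ K ε t₂) := by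
  have hdiff : Differentiable ℝ (gronwallBound δ K ε) := fun y =>
    (hasDerivAt_gronwallBound δ K ε y).differentiableAt
  have hder : ∀ y, deriv (gronwallBound δ K ε) y = (K * δ + ε) * Real.exp (K * y) := fun y => by
    rw [(hasDerivAt_gronwallBound δ K ε y).deriv, gronwallBound_deriv_eq]
  rcases le_or_gt 0 (K * δ + ε) with hs | hs
  · have hmono : Monotone (gronwallBound δ K ε) :=
      monotone_of_deriv_nonneg hdiff fun y => by
        rw [hder]; exact mul_nonneg hs (Real.exp_nonneg _)
    exact ⟨(min_le_left _ _).trans (hmono ht.1), (hmono ht.2).trans (le_max_right _ _)⟩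
  · have hanti : Antitone (gronwallBound δ K ε) :=
      antitone_of_deriv_nonpos hdiff fun y => by
        rw [hder]; exact mul_nonpos_of_nonpos_of_nonneg hs.le (Real.exp_nonneg _)
    exact ⟨(min_le_right _ _).trans (hanti ht.2), (hanti ht.1).trans (le_max_left _ _)⟩

/-- An affine envelope lies between its endpoint values on a time interval. [folklore] -/
theorem affine_mem_endpoints (x₀ ρ : ℝ) {t₁ t₂ t : ℝ} (ht : t ∈ Icc t₁ t₂) :
    min (x₀ + ρ * t₁) (x₀ + ρ * t₂) ≤ x₀ + ρ * t ∧ x₀ + ρ * t ≤ max (x₀ + ρ * t₁) (x₀ + ρ * t₂) := by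
  rcases le_or_gt 0 ρ with hρ | hρ
  · have h1 := mul_le_mul_of_nonneg_left ht.1 hρ
    have h2 := mul_le_mul_of_nonneg_left ht.2 hρ
    exact ⟨(min_le_left _ _).trans (by linarith), le_trans (by linarith) (le_max_right _ _)⟩
  · have h1 := mul_le_mul_of_nonpos_left ht.1 hρ.le
    have h2 := mul_le_mul_of_nonpos_left ht.2 hρ.le
    exact ⟨(min_le_right _ _).trans (by linarith), le_trans (by linarith) (le_max_left _ _)⟩

/-- `x₀e^{-Kt} - δt ≤ -gronwallBound(-x₀, -K, δ, t)` for `K, δ ≥ 0`: the relaxation floor with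
rate `K` and forcing `-δ` is at least "free decay minus `δt`". [folklore] -/
theorem exp_sub_lin_le_neg_gronwallBound {x₀ K δ' : ℝ} (t : ℝ) (hK : 0 ≤ K) (hδ : 0 ≤ δ') :
    x₀ * Real.exp (-K * t) - δ' * t ≤ -gronwallBound (-x₀) (-K) δ' t := by
  rcases eq_or_lt_of_le hK with h | h
  · subst h
    simp only [neg_zero, gronwallBound_K0, zero_mul, Real.exp_zero, mul_one]
    linarith
  · have hK0 : -K ≠ 0 := by linarith
    rw [gronwallBound_of_K_ne_0 hK0]
    have h1 : -K * t + 1 ≤ Real.exp (-K * t) := Real.add_one_le_exp _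
    have h3 : δ' / K * (-K * t) ≤ δ' / K * (Real.exp (-K * t) - 1) :=
      mul_le_mul_of_nonneg_left (by linarith) (div_nonneg hδ h.le)
    have h2 : δ' / K * (-K * t) = -(δ' * t) := by field_simp
    have h4 : δ' / -K * (Real.exp (-K * t) - 1) = -(δ' / K * (Real.exp (-K * t) - 1)) := by
      rw [div_neg]; ring
    simp only [h4]
    linarith

/-- `x₀(1 - Kt) ≤ x₀e^{-Kt}` for `x₀ ≥ 0` (convexity of the exponential). [folklore] -/
theorem lin_le_exp_decay {x₀ K t : ℝ} (hx₀ : 0 ≤ x₀) :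
    x₀ * (1 - K * t) ≤ x₀ * Real.exp (-K * t) :=
  mul_le_mul_of_nonneg_left (by linarith [Real.add_one_le_exp (-K * t)]) hx₀

/-! ### Box algebra: net rate, residual and signs from a box -/

/-- The net trigger rate `νb - μa` from the boxes of `a` and `b`. [folklore] -/
theorem netRate_mem_of_box (hν : 0 ≤ ν) (hμ : 0 ≤ μ) {Aℓ Ah Bℓ Bh : ℝ} {X : Fin 5 → ℝ}
    (ha : Aℓ ≤ X 0 ∧ X 0 ≤ Ah) (hb : Bℓ ≤ X 1 ∧ X 1 ≤ Bh) :
    ν * Bℓ - μ * Ah ≤ ν * X 1 - μ * X 0 ∧ ν * X 1 - μ * X 0 ≤ ν * Bh - μ * Aℓ := by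
  have e1 := mul_le_mul_of_nonneg_left hb.1 hν
  have e2 := mul_le_mul_of_nonneg_left hb.2 hν
  have e3 := mul_le_mul_of_nonneg_left ha.1 hμ
  have e4 := mul_le_mul_of_nonneg_left ha.2 hμ
  constructor <;> linarith

/-- The residual `κdã - rca` from the boxes of `a, c, d, ã` (all `≥ 0`). [folklore] -/
theorem slavingResidual_mem_of_box (hr : 0 ≤ r) (hκ : 0 ≤ κ) {Aℓ Ah cℓ ch Dℓ Dh Zℓ Zh : ℝ}
    (hAℓ : 0 ≤ Aℓ) (hcℓ : 0 ≤ cℓ) (hDℓ : 0 ≤ Dℓ) (hZℓ : 0 ≤ Zℓ) {X : Fin 5 → ℝ}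
    (ha : Aℓ ≤ X 0 ∧ X 0 ≤ Ah) (hc : cℓ ≤ X 2 ∧ X 2 ≤ ch) (hd : Dℓ ≤ X 3 ∧ X 3 ≤ Dh)
    (hz : Zℓ ≤ X 4 ∧ X 4 ≤ Zh) :
    κ * Dℓ * Zℓ - r * ch * Ah ≤ slavingResidual κ r X ∧
      slavingResidual κ r X ≤ κ * Dh * Zh - r * cℓ * Aℓ := by
  simp only [slavingResidual_apply]
  have ha0 : 0 ≤ X 0 := hAℓ.trans ha.1
  have hc0 : 0 ≤ X 2 := hcℓ.trans hc.1
  have hd0 : 0 ≤ X 3 := hDℓ.trans hd.1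
  have hz0 : 0 ≤ X 4 := hZℓ.trans hz.1
  have e1 : κ * Dℓ * Zℓ ≤ κ * X 3 * X 4 :=
    mul_le_mul (mul_le_mul_of_nonneg_left hd.1 hκ) hz.1 hZℓ (mul_nonneg hκ hd0)
  have e2 : κ * X 3 * X 4 ≤ κ * Dh * Zh :=
    mul_le_mul (mul_le_mul_of_nonneg_left hd.2 hκ) hz.2 hz0 (mul_nonneg hκ (hd0.trans hd.2))
  have e3 : r * cℓ * Aℓ ≤ r * X 2 * X 0 :=
    mul_le_mul (mul_le_mul_of_nonneg_left hc.1 hr) ha.1 hAℓ (mul_nonneg hr hc0)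
  have e4 : r * X 2 * X 0 ≤ r * ch * Ah :=
    mul_le_mul (mul_le_mul_of_nonneg_left hc.2 hr) ha.2 ha0 (mul_nonneg hr (hc0.trans hc.2))
  constructor <;> linarith

/-- **Sign bootstrap (real induction, pure continuity).** If the coordinates `i ∈ S` of a curve
continuous on `[0, τ]` are positive at time `0` and, whenever they are nonnegative on `[0, s]`
(`s ∈ [0, τ]`), they are in fact positive at time `s`, then they are nonnegative on all of
`[0, τ]`. In the level step the inner implication is discharged by the crude rungs. [folklore] -/
theorem nonneg_persist (hcont : ContinuousOn x (Icc 0 τ)) (hτ : 0 ≤ τ) (S : Set (Fin 5))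
    (h0 : ∀ i ∈ S, 0 < x 0 i)
    (hstep : ∀ s ∈ Icc 0 τ, (∀ t ∈ Icc 0 s, ∀ i ∈ S, 0 ≤ x t i) → ∀ i ∈ S, 0 < x s i) :
    ∀ t ∈ Icc 0 τ, ∀ i ∈ S, 0 ≤ x t i := by
  set P : ℝ → Prop := fun s => ∀ i ∈ S, 0 ≤ x s i with hP
  have hPa : P 0 := fun i hi => (h0 i hi).le
  have hTmem : maximalTimeP P 0 τ ∈ Icc 0 τ := maximalTimeP_mem hτ hPa
  have hclosed : ∀ t ∈ Ioc 0 τ, (∀ s ∈ Ico 0 t, P s) → P t := by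
    intro t ht hs i hi
    have hg : ContinuousOn (fun s => -x s i) (Icc 0 τ) :=
      ((continuous_apply i).comp_continuousOn hcont).neg
    have := le_const_of_forall_Ico (C := 0) hg ht (fun s hs' => by
      have := hs s hs' i hi
      show -x s i ≤ 0
      linarith)
    linarith
  have hPT : ∀ t ∈ Icc 0 (maximalTimeP P 0 τ), P t :=
    fun t ht => maximalTimeP_spec hτ hPa hclosed ht
  have hTeq : maximalTimeP P 0 τ = τ := by
    by_contra hne
    have hlt : maximalTimeP P 0 τ < τ := lt_of_le_of_ne hTmem.2 hne
    have hpos : ∀ i ∈ S, 0 < x (maximalTimeP P 0 τ) i := hstep _ hTmem hPT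
    have hev : ∀ᶠ t in 𝓝[Icc 0 τ] (maximalTimeP P 0 τ), P t := by
      have hi : ∀ i ∈ S, ∀ᶠ t in 𝓝[Icc 0 τ] (maximalTimeP P 0 τ), 0 < x t i := fun i hi =>
        Filter.Tendsto.eventually_const_lt (hpos i hi)
          ((continuous_apply i).comp_continuousOn hcont _ hTmem)
      exact ((Filter.eventually_all_finite S.toFinite).2 hi).mono fun t ht i hi => (ht i hi).le
    exact not_eventually_of_maximalTimeP_lt hτ hPa hlt hev
  intro t ht
  exact hPT t (by rw [hTeq]; exact ht)

namespace IsForcedWindow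

/-- The residual is right-differentiable along a forced window, with derivative
`κ(V₃ã + dV₄) - r(V₂a + cV₀)`. [folklore] -/
theorem hasDerivWithinAt_slavingResidual {V : Fin 5 → ℝ} {t : ℝ}
    (hV : HasDerivWithinAt x V (Ici t) t) :
    HasDerivWithinAt (fun s => slavingResidual κ r (x s))
      (κ * (V 3 * x t 4 + x t 3 * V 4) - r * (V 2 * x t 0 + x t 2 * V 0)) (Ici t) t := by
  have h0 := (hasDerivWithinAt_pi.1 hV) 0
  have h2 := (hasDerivWithinAt_pi.1 hV) 2
  have h3 := (hasDerivWithinAt_pi.1 hV) 3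
  have h4 := (hasDerivWithinAt_pi.1 hV) 4
  have h34 := (h3.mul h4).const_mul κ
  have h20 := (h2.mul h0).const_mul r
  refine (h34.sub h20).congr_of_eventuallyEq ?_ ?_
  · exact Filter.Eventually.of_forall fun s => by simp [slavingResidual]; ring
  · simp [slavingResidual]; ring

/-- Continuity of the residual along the window. [folklore] -/
theorem continuousOn_slavingResidual (h : IsForcedWindow ε σ ν μ r κ δ τ x) :
    ContinuousOn (fun s => slavingResidual κ r (x s)) (Icc 0 τ) := by
  have h0 := (continuous_apply 0).comp_continuousOn h.continuousOn
  have h2 := (continuous_apply 2).comp_continuousOn h.continuousOn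
  have h3 := (continuous_apply 3).comp_continuousOn h.continuousOn
  have h4 := (continuous_apply 4).comp_continuousOn h.continuousOn
  simp only [slavingResidual_apply]
  exact (((h3.const_smul κ).mul h4).sub ((h2.const_smul r).mul h0)).congr
    (fun s _ => by
      simp only [Function.comp_apply, Pi.mul_apply, Pi.sub_apply, Pi.smul_apply, smul_eq_mul])

/-! ### The residual: exponential relaxation floor and ceiling -/

section Residual

variable {Aℓ Ah Bℓ Bh cℓ ch Dℓ Dh Zℓ Zh gℓ gh Wℓ : ℝ}

/-- **Monomial-wise floor of the source `Ψ` on a box** (all modes `≥ 0`, net rate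
`νb - μa ∈ [gℓ, gh]`, `gℓ ≥ 0`). [folklore] -/
theorem slavingSource_ge (hε : 0 ≤ ε) (hσ : 0 ≤ σ) (hμ : 0 ≤ μ) (hr : 0 ≤ r)
    (hκ : 0 ≤ κ) (hAℓ : 0 ≤ Aℓ) (hBℓ : 0 ≤ Bℓ) (hcℓ : 0 ≤ cℓ) (hDℓ : 0 ≤ Dℓ) (hgℓ : 0 ≤ gℓ)
    {X : Fin 5 → ℝ} (ha : Aℓ ≤ X 0 ∧ X 0 ≤ Ah) (hb : Bℓ ≤ X 1 ∧ X 1 ≤ Bh)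
    (hc : cℓ ≤ X 2 ∧ X 2 ≤ ch) (hd : Dℓ ≤ X 3 ∧ X 3 ≤ Dh)
    (hg : gℓ ≤ ν * X 1 - μ * X 0 ∧ ν * X 1 - μ * X 0 ≤ gh) :
    κ ^ 2 * Dℓ ^ 3 - r * σ * Ah ^ 3 - r * gh * Ah * ch + r * ε * Aℓ * Bℓ * cℓ +
        r * σ * Aℓ * cℓ ^ 2 - r * μ * ch ^ 3 + r ^ 2 * cℓ ^ 2 * Dℓ ≤
      slavingSource ε σ ν μ r κ X := by
  have ha0 : 0 ≤ X 0 := hAℓ.trans ha.1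
  have hb0 : 0 ≤ X 1 := hBℓ.trans hb.1
  have hc0 : 0 ≤ X 2 := hcℓ.trans hc.1
  have hd0 : 0 ≤ X 3 := hDℓ.trans hd.1
  have hg0 : 0 ≤ ν * X 1 - μ * X 0 := hgℓ.trans hg.1
  have e1 : Dℓ ^ 3 ≤ X 3 ^ 3 := pow_le_pow_left₀ hDℓ hd.1 3
  have e2 : X 0 ^ 3 ≤ Ah ^ 3 := pow_le_pow_left₀ ha0 ha.2 3
  have e3 : (ν * X 1 - μ * X 0) * X 0 * X 2 ≤ gh * Ah * ch :=
    mul_le_mul (mul_le_mul hg.2 ha.2 ha0 (hg0.trans hg.2)) hc.2 hc0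
      (mul_nonneg (hg0.trans hg.2) (ha0.trans ha.2))
  have e4 : Aℓ * Bℓ * cℓ ≤ X 0 * X 1 * X 2 :=
    mul_le_mul (mul_le_mul ha.1 hb.1 hBℓ ha0) hc.1 hcℓ (mul_nonneg ha0 hb0)
  have e5 : Aℓ * cℓ ^ 2 ≤ X 0 * X 2 ^ 2 :=
    mul_le_mul ha.1 (pow_le_pow_left₀ hcℓ hc.1 2) (sq_nonneg _) ha0
  have e6 : X 2 ^ 3 ≤ ch ^ 3 := pow_le_pow_left₀ hc0 hc.2 3
  have e7 : cℓ ^ 2 * Dℓ ≤ X 2 ^ 2 * X 3 :=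
    mul_le_mul (pow_le_pow_left₀ hcℓ hc.1 2) hd.1 hDℓ (sq_nonneg _)
  have f1 := mul_le_mul_of_nonneg_left e1 (pow_nonneg hκ 2)
  have f2 := mul_le_mul_of_nonneg_left e2 (mul_nonneg hr hσ)
  have f3 := mul_le_mul_of_nonneg_left e3 hr
  have f4 := mul_le_mul_of_nonneg_left e4 (mul_nonneg hr hε)
  have f5 := mul_le_mul_of_nonneg_left e5 (mul_nonneg hr hσ)
  have f6 := mul_le_mul_of_nonneg_left e6 (mul_nonneg hr hμ)
  have f7 := mul_le_mul_of_nonneg_left e7 (pow_nonneg hr 2)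
  simp only [slavingSource]
  nlinarith [f1, f2, f3, f4, f5, f6, f7]

/-- **Monomial-wise ceiling of the source `Ψ` on a box.** [folklore] -/
theorem slavingSource_le (hε : 0 ≤ ε) (hσ : 0 ≤ σ) (hμ : 0 ≤ μ) (hr : 0 ≤ r)
    (hκ : 0 ≤ κ) (hAℓ : 0 ≤ Aℓ) (hBℓ : 0 ≤ Bℓ) (hcℓ : 0 ≤ cℓ) (hDℓ : 0 ≤ Dℓ) (hgℓ : 0 ≤ gℓ)
    {X : Fin 5 → ℝ} (ha : Aℓ ≤ X 0 ∧ X 0 ≤ Ah) (hb : Bℓ ≤ X 1 ∧ X 1 ≤ Bh)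
    (hc : cℓ ≤ X 2 ∧ X 2 ≤ ch) (hd : Dℓ ≤ X 3 ∧ X 3 ≤ Dh)
    (hg : gℓ ≤ ν * X 1 - μ * X 0 ∧ ν * X 1 - μ * X 0 ≤ gh) :
    slavingSource ε σ ν μ r κ X ≤
      κ ^ 2 * Dh ^ 3 - r * σ * Aℓ ^ 3 - r * gℓ * Aℓ * cℓ + r * ε * Ah * Bh * ch +
        r * σ * Ah * ch ^ 2 - r * μ * cℓ ^ 3 + r ^ 2 * ch ^ 2 * Dh := by
  have ha0 : 0 ≤ X 0 := hAℓ.trans ha.1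
  have hb0 : 0 ≤ X 1 := hBℓ.trans hb.1
  have hc0 : 0 ≤ X 2 := hcℓ.trans hc.1
  have hd0 : 0 ≤ X 3 := hDℓ.trans hd.1
  have hg0 : 0 ≤ ν * X 1 - μ * X 0 := hgℓ.trans hg.1
  have hAh : 0 ≤ Ah := ha0.trans ha.2
  have hch : 0 ≤ ch := hc0.trans hc.2
  have hDh : 0 ≤ Dh := hd0.trans hd.2
  have e1 : X 3 ^ 3 ≤ Dh ^ 3 := pow_le_pow_left₀ hd0 hd.2 3
  have e2 : Aℓ ^ 3 ≤ X 0 ^ 3 := pow_le_pow_left₀ hAℓ ha.1 3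
  have e3 : gℓ * Aℓ * cℓ ≤ (ν * X 1 - μ * X 0) * X 0 * X 2 :=
    mul_le_mul (mul_le_mul hg.1 ha.1 hAℓ hg0) hc.1 hcℓ (mul_nonneg hg0 ha0)
  have e4 : X 0 * X 1 * X 2 ≤ Ah * Bh * ch :=
    mul_le_mul (mul_le_mul ha.2 hb.2 hb0 hAh) hc.2 hc0 (mul_nonneg hAh (hb0.trans hb.2))
  have e5 : X 0 * X 2 ^ 2 ≤ Ah * ch ^ 2 :=
    mul_le_mul ha.2 (pow_le_pow_left₀ hc0 hc.2 2) (sq_nonneg _) hAh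
  have e6 : cℓ ^ 3 ≤ X 2 ^ 3 := pow_le_pow_left₀ hcℓ hc.1 3
  have e7 : X 2 ^ 2 * X 3 ≤ ch ^ 2 * Dh :=
    mul_le_mul (pow_le_pow_left₀ hc0 hc.2 2) hd.2 hd0 (sq_nonneg _)
  have f1 := mul_le_mul_of_nonneg_left e1 (pow_nonneg hκ 2)
  have f2 := mul_le_mul_of_nonneg_left e2 (mul_nonneg hr hσ)
  have f3 := mul_le_mul_of_nonneg_left e3 hr
  have f4 := mul_le_mul_of_nonneg_left e4 (mul_nonneg hr hε)
  have f5 := mul_le_mul_of_nonneg_left e5 (mul_nonneg hr hσ)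
  have f6 := mul_le_mul_of_nonneg_left e6 (mul_nonneg hr hμ)
  have f7 := mul_le_mul_of_nonneg_left e7 (pow_nonneg hr 2)
  simp only [slavingSource]
  nlinarith [f1, f2, f3, f4, f5, f6, f7]

/-- The forcing part of the residual's derivative is at most `δ(κZh + κDh + r(Ah + ch))` in absolute
value. [folklore] -/
theorem slavingResidual_forcing_abs_le (hr : 0 ≤ r) (hκ : 0 ≤ κ) {X V : Fin 5 → ℝ}
    (hVδ : ‖V - thresholdCircuit ε σ ν μ r κ X‖ ≤ δ)
    (ha : 0 ≤ X 0 ∧ X 0 ≤ Ah) (hc : 0 ≤ X 2 ∧ X 2 ≤ ch) (hd : 0 ≤ X 3 ∧ X 3 ≤ Dh)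
    (hz : 0 ≤ X 4 ∧ X 4 ≤ Zh) :
    |κ * (V 3 * X 4 + X 3 * V 4) - r * (V 2 * X 0 + X 2 * V 0) -
        (κ * (thresholdCircuit ε σ ν μ r κ X 3 * X 4 + X 3 * thresholdCircuit ε σ ν μ r κ X 4) -
          r * (thresholdCircuit ε σ ν μ r κ X 2 * X 0 + X 2 * thresholdCircuit ε σ ν μ r κ X 0))| ≤
      δ * (κ * Zh + κ * Dh + r * (Ah + ch)) := by
  set F := thresholdCircuit ε σ ν μ r κ X with hF
  have hδ : 0 ≤ δ := (norm_nonneg _).trans hVδ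
  have g0 := abs_apply_le_of_norm_le hVδ 0
  have g2 := abs_apply_le_of_norm_le hVδ 2
  have g3 := abs_apply_le_of_norm_le hVδ 3
  have g4 := abs_apply_le_of_norm_le hVδ 4
  simp only [Pi.sub_apply] at g0 g2 g3 g4
  have e : κ * (V 3 * X 4 + X 3 * V 4) - r * (V 2 * X 0 + X 2 * V 0) -
      (κ * (F 3 * X 4 + X 3 * F 4) - r * (F 2 * X 0 + X 2 * F 0)) =
      κ * ((V 3 - F 3) * X 4) + κ * (X 3 * (V 4 - F 4)) - r * ((V 2 - F 2) * X 0) -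
        r * (X 2 * (V 0 - F 0)) := by ring
  rw [e]
  have b3 : |(V 3 - F 3) * X 4| ≤ δ * Zh := by
    rw [abs_mul, abs_of_nonneg hz.1]; exact mul_le_mul g3 hz.2 hz.1 hδ
  have b4 : |X 3 * (V 4 - F 4)| ≤ Dh * δ := by
    rw [abs_mul, abs_of_nonneg hd.1]; exact mul_le_mul hd.2 g4 (abs_nonneg _) (hd.1.trans hd.2)
  have b2 : |(V 2 - F 2) * X 0| ≤ δ * Ah := by
    rw [abs_mul, abs_of_nonneg ha.1]; exact mul_le_mul g2 ha.2 ha.1 hδ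
  have b0 : |X 2 * (V 0 - F 0)| ≤ ch * δ := by
    rw [abs_mul, abs_of_nonneg hc.1]; exact mul_le_mul hc.2 g0 (abs_nonneg _) (hc.1.trans hc.2)
  have c3 := abs_le.1 b3; have c4 := abs_le.1 b4; have c2 := abs_le.1 b2; have c0 := abs_le.1 b0
  rw [abs_le]
  constructor <;> nlinarith [c3.1, c3.2, c4.1, c4.2, c2.1, c2.2, c0.1, c0.2, hκ, hr]

/-- **Residual floor (exponential relaxation).** On a forced window where the modes lie in a box
with `a, b, c, d, ã ≥ 0`, net rate `νb - μa ∈ [gℓ, gh]` (`gℓ ≥ 0`) and the residual is `≥ Wℓ`: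
`w' ≥ -κZh·w + sℓ` with
`sℓ = Ψℓ - δ(κZh + κDh + r(Ah + ch)) - κ(Zh - Zℓ)·max(-Wℓ, 0)`, hence
`w(t) ≥ -gronwallBound(-w(0), -κZh, -sℓ, t) = sℓ/(κZh) + (w(0) - sℓ/(κZh))e^{-κZh t}`. [folklore] -/
theorem slavingResidual_ge (h : IsForcedWindow ε σ ν μ r κ δ τ x) (hε : 0 ≤ ε) (hσ : 0 ≤ σ)
    (hμ : 0 ≤ μ) (hr : 0 ≤ r) (hκ : 0 ≤ κ)
    (hAℓ : 0 ≤ Aℓ) (hBℓ : 0 ≤ Bℓ) (hcℓ : 0 ≤ cℓ) (hDℓ : 0 ≤ Dℓ) (hZℓ : 0 ≤ Zℓ) (hgℓ : 0 ≤ gℓ)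
    (ha : ∀ t ∈ Ico 0 τ, Aℓ ≤ x t 0 ∧ x t 0 ≤ Ah) (hb : ∀ t ∈ Ico 0 τ, Bℓ ≤ x t 1 ∧ x t 1 ≤ Bh)
    (hc : ∀ t ∈ Ico 0 τ, cℓ ≤ x t 2 ∧ x t 2 ≤ ch) (hd : ∀ t ∈ Ico 0 τ, Dℓ ≤ x t 3 ∧ x t 3 ≤ Dh)
    (hz : ∀ t ∈ Ico 0 τ, Zℓ ≤ x t 4 ∧ x t 4 ≤ Zh)
    (hg : ∀ t ∈ Ico 0 τ, gℓ ≤ ν * x t 1 - μ * x t 0 ∧ ν * x t 1 - μ * x t 0 ≤ gh)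
    (hw : ∀ t ∈ Ico 0 τ, Wℓ ≤ slavingResidual κ r (x t)) :
    ∀ t ∈ Icc 0 τ,
      -gronwallBound (-slavingResidual κ r (x 0)) (-(κ * Zh))
          (-(κ ^ 2 * Dℓ ^ 3 - r * σ * Ah ^ 3 - r * gh * Ah * ch + r * ε * Aℓ * Bℓ * cℓ +
              r * σ * Aℓ * cℓ ^ 2 - r * μ * ch ^ 3 + r ^ 2 * cℓ ^ 2 * Dℓ -
            δ * (κ * Zh + κ * Dh + r * (Ah + ch)) - κ * (Zh - Zℓ) * max (-Wℓ) 0)) t ≤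
        slavingResidual κ r (x t) := by
  choose! V hV hVδ using h.defect
  set W' : ℝ → ℝ := fun s =>
    κ * (V s 3 * x s 4 + x s 3 * V s 4) - r * (V s 2 * x s 0 + x s 2 * V s 0) with hW'
  have hdv : ∀ s ∈ Ico 0 τ,
      HasDerivWithinAt (fun s => slavingResidual κ r (x s)) (W' s) (Ici s) s :=
    fun s hs => hasDerivWithinAt_slavingResidual (hV s hs)
  have hbd : ∀ s ∈ Ico 0 τ,
      -(κ * Zh) * slavingResidual κ r (x s) -
          -(κ ^ 2 * Dℓ ^ 3 - r * σ * Ah ^ 3 - r * gh * Ah * ch + r * ε * Aℓ * Bℓ * cℓ +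
              r * σ * Aℓ * cℓ ^ 2 - r * μ * ch ^ 3 + r ^ 2 * cℓ ^ 2 * Dℓ -
            δ * (κ * Zh + κ * Dh + r * (Ah + ch)) - κ * (Zh - Zℓ) * max (-Wℓ) 0) ≤ W' s := by
    intro s hs
    have hfrc := slavingResidual_forcing_abs_le (ε := ε) (σ := σ) (ν := ν) (μ := μ) hr hκ
      (hVδ s hs) ⟨hAℓ.trans (ha s hs).1, (ha s hs).2⟩ ⟨hcℓ.trans (hc s hs).1, (hc s hs).2⟩
      ⟨hDℓ.trans (hd s hs).1, (hd s hs).2⟩ ⟨hZℓ.trans (hz s hs).1, (hz s hs).2⟩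
    have hΨ := slavingSource_ge hε hσ hμ hr hκ hAℓ hBℓ hcℓ hDℓ hgℓ (ha s hs) (hb s hs)
      (hc s hs) (hd s hs) (hg s hs)
    have heq := slavingResidual_deriv_eq ε σ ν μ r κ (x s)
    have hfr := (abs_le.1 hfrc).1
    -- the relaxation term: -κ ã w ≥ -κ Zh w - κ (Zh - Zℓ) max(-Wℓ, 0)
    have hrel : -(κ * Zh) * slavingResidual κ r (x s) - κ * (Zh - Zℓ) * max (-Wℓ) 0 ≤
        -(κ * x s 4) * slavingResidual κ r (x s) := by
      have hz1 := (hz s hs).1; have hz2 := (hz s hs).2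
      have hZhℓ : 0 ≤ Zh - Zℓ := by linarith
      have hm0 : 0 ≤ max (-Wℓ) 0 := le_max_right _ _
      rcases le_or_gt 0 (slavingResidual κ r (x s)) with hw0 | hw0
      · have : κ * x s 4 * slavingResidual κ r (x s) ≤ κ * Zh * slavingResidual κ r (x s) :=
          mul_le_mul_of_nonneg_right (mul_le_mul_of_nonneg_left hz2 hκ) hw0
        nlinarith [mul_nonneg (mul_nonneg hκ hZhℓ) hm0]
      · have hnw : 0 ≤ -slavingResidual κ r (x s) := by linarith
        have h1 : κ * (Zh - x s 4) * (-slavingResidual κ r (x s)) ≤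
            κ * (Zh - Zℓ) * max (-Wℓ) 0 := by
          have hWs := hw s hs
          exact mul_le_mul (mul_le_mul_of_nonneg_left (by linarith) hκ)
            (le_trans (by linarith) (le_max_left _ _)) hnw (mul_nonneg hκ hZhℓ)
        nlinarith [h1]
    have : W' s = (W' s - (κ * (thresholdCircuit ε σ ν μ r κ (x s) 3 * x s 4 +
        x s 3 * thresholdCircuit ε σ ν μ r κ (x s) 4) -
        r * (thresholdCircuit ε σ ν μ r κ (x s) 2 * x s 0 +
          x s 2 * thresholdCircuit ε σ ν μ r κ (x s) 0))) +
        (-(κ * x s 4) * slavingResidual κ r (x s) + slavingSource ε σ ν μ r κ (x s)) := by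
      rw [← heq]; ring
    rw [this]
    linarith
  intro t ht
  have := gronwallBound_neg_le_of_le_deriv_right h.continuousOn_slavingResidual hdv hbd t ht
  simpa using this

/-- **Residual ceiling (exponential relaxation).** Same box; `w' ≤ -κZℓ·w + sh` with
`sh = Ψh + δ(κZh + κDh + r(Ah + ch)) + κ(Zh - Zℓ)·max(-Wℓ, 0)`, hence
`w(t) ≤ gronwallBound(w(0), -κZℓ, sh, t) = sh/(κZℓ) + (w(0) - sh/(κZℓ))e^{-κZℓ t}`. [folklore] -/
theorem slavingResidual_le (h : IsForcedWindow ε σ ν μ r κ δ τ x) (hε : 0 ≤ ε) (hσ : 0 ≤ σ)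
    (hμ : 0 ≤ μ) (hr : 0 ≤ r) (hκ : 0 ≤ κ)
    (hAℓ : 0 ≤ Aℓ) (hBℓ : 0 ≤ Bℓ) (hcℓ : 0 ≤ cℓ) (hDℓ : 0 ≤ Dℓ) (hZℓ : 0 ≤ Zℓ) (hgℓ : 0 ≤ gℓ)
    (ha : ∀ t ∈ Ico 0 τ, Aℓ ≤ x t 0 ∧ x t 0 ≤ Ah) (hb : ∀ t ∈ Ico 0 τ, Bℓ ≤ x t 1 ∧ x t 1 ≤ Bh)
    (hc : ∀ t ∈ Ico 0 τ, cℓ ≤ x t 2 ∧ x t 2 ≤ ch) (hd : ∀ t ∈ Ico 0 τ, Dℓ ≤ x t 3 ∧ x t 3 ≤ Dh)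
    (hz : ∀ t ∈ Ico 0 τ, Zℓ ≤ x t 4 ∧ x t 4 ≤ Zh)
    (hg : ∀ t ∈ Ico 0 τ, gℓ ≤ ν * x t 1 - μ * x t 0 ∧ ν * x t 1 - μ * x t 0 ≤ gh)
    (hw : ∀ t ∈ Ico 0 τ, Wℓ ≤ slavingResidual κ r (x t)) :
    ∀ t ∈ Icc 0 τ,
      slavingResidual κ r (x t) ≤
        gronwallBound (slavingResidual κ r (x 0)) (-(κ * Zℓ))
          (κ ^ 2 * Dh ^ 3 - r * σ * Aℓ ^ 3 - r * gℓ * Aℓ * cℓ + r * ε * Ah * Bh * ch +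
              r * σ * Ah * ch ^ 2 - r * μ * cℓ ^ 3 + r ^ 2 * ch ^ 2 * Dh +
            δ * (κ * Zh + κ * Dh + r * (Ah + ch)) + κ * (Zh - Zℓ) * max (-Wℓ) 0) t := by
  choose! V hV hVδ using h.defect
  set W' : ℝ → ℝ := fun s =>
    κ * (V s 3 * x s 4 + x s 3 * V s 4) - r * (V s 2 * x s 0 + x s 2 * V s 0) with hW'
  have hdv : ∀ s ∈ Ico 0 τ,
      HasDerivWithinAt (fun s => slavingResidual κ r (x s)) (W' s) (Ici s) s :=
    fun s hs => hasDerivWithinAt_slavingResidual (hV s hs)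
  have hbd : ∀ s ∈ Ico 0 τ, W' s ≤ -(κ * Zℓ) * slavingResidual κ r (x s) +
      (κ ^ 2 * Dh ^ 3 - r * σ * Aℓ ^ 3 - r * gℓ * Aℓ * cℓ + r * ε * Ah * Bh * ch +
          r * σ * Ah * ch ^ 2 - r * μ * cℓ ^ 3 + r ^ 2 * ch ^ 2 * Dh +
        δ * (κ * Zh + κ * Dh + r * (Ah + ch)) + κ * (Zh - Zℓ) * max (-Wℓ) 0) := by
    intro s hs
    have hfrc := slavingResidual_forcing_abs_le (ε := ε) (σ := σ) (ν := ν) (μ := μ) hr hκ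
      (hVδ s hs) ⟨hAℓ.trans (ha s hs).1, (ha s hs).2⟩ ⟨hcℓ.trans (hc s hs).1, (hc s hs).2⟩
      ⟨hDℓ.trans (hd s hs).1, (hd s hs).2⟩ ⟨hZℓ.trans (hz s hs).1, (hz s hs).2⟩
    have hΨ := slavingSource_le hε hσ hμ hr hκ hAℓ hBℓ hcℓ hDℓ hgℓ (ha s hs) (hb s hs)
      (hc s hs) (hd s hs) (hg s hs)
    have heq := slavingResidual_deriv_eq ε σ ν μ r κ (x s)
    have hfr := (abs_le.1 hfrc).2
    -- the relaxation term: -κ ã w ≤ -κ Zℓ w + κ (Zh - Zℓ) max(-Wℓ, 0)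
    have hrel : -(κ * x s 4) * slavingResidual κ r (x s) ≤
        -(κ * Zℓ) * slavingResidual κ r (x s) + κ * (Zh - Zℓ) * max (-Wℓ) 0 := by
      have hz1 := (hz s hs).1; have hz2 := (hz s hs).2
      have hZhℓ : 0 ≤ Zh - Zℓ := by linarith
      have hm0 : 0 ≤ max (-Wℓ) 0 := le_max_right _ _
      rcases le_or_gt 0 (slavingResidual κ r (x s)) with hw0 | hw0
      · have : κ * Zℓ * slavingResidual κ r (x s) ≤ κ * x s 4 * slavingResidual κ r (x s) :=
          mul_le_mul_of_nonneg_right (mul_le_mul_of_nonneg_left hz1 hκ) hw0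
        nlinarith [mul_nonneg (mul_nonneg hκ hZhℓ) hm0]
      · have hnw : 0 ≤ -slavingResidual κ r (x s) := by linarith
        have h1 : κ * (x s 4 - Zℓ) * (-slavingResidual κ r (x s)) ≤
            κ * (Zh - Zℓ) * max (-Wℓ) 0 := by
          have hWs := hw s hs
          exact mul_le_mul (mul_le_mul_of_nonneg_left (by linarith) hκ)
            (le_trans (by linarith) (le_max_left _ _)) hnw (mul_nonneg hκ hZhℓ)
        nlinarith [h1]
    have : W' s = (W' s - (κ * (thresholdCircuit ε σ ν μ r κ (x s) 3 * x s 4 +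
        x s 3 * thresholdCircuit ε σ ν μ r κ (x s) 4) -
        r * (thresholdCircuit ε σ ν μ r κ (x s) 2 * x s 0 +
          x s 2 * thresholdCircuit ε σ ν μ r κ (x s) 0))) +
        (-(κ * x s 4) * slavingResidual κ r (x s) + slavingSource ε σ ν μ r κ (x s)) := by
      rw [← heq]; ring
    rw [this]
    linarith
  intro t ht
  have := le_gronwallBound_of_deriv_right_le h.continuousOn_slavingResidual hdv hbd t ht
  simpa using this

end Residual

/-! ### The carrier: linear comparison once the rotor term is bounded -/

/-- **Carrier floor.** While `a ≥ 0`, `0 ≤ b ≤ Bh`, `cℓ ≤ c ≤ ch` (`cℓ ≥ 0`) and the rotor term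
obeys `r·d·c ≤ L·a + M` on `[0, τ)`: `∂ₜa ≥ -(εBh + σch + L)a + (μcℓ² - M - δ)`, hence
`a(t) ≥ -gronwallBound(-a(0), -(εBh + σch + L), -(μcℓ² - M - δ), t)`. [folklore] -/
theorem carrier_ge_gronwall (h : IsForcedWindow ε σ ν μ r κ δ τ x) (hε : 0 ≤ ε) (hσ : 0 ≤ σ)
    (hμ : 0 ≤ μ) {Bh cℓ ch L M : ℝ} (hcℓ : 0 ≤ cℓ)
    (ha : ∀ t ∈ Ico 0 τ, 0 ≤ x t 0) (hb : ∀ t ∈ Ico 0 τ, 0 ≤ x t 1 ∧ x t 1 ≤ Bh)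
    (hc : ∀ t ∈ Ico 0 τ, cℓ ≤ x t 2 ∧ x t 2 ≤ ch)
    (hrot : ∀ t ∈ Ico 0 τ, r * x t 3 * x t 2 ≤ L * x t 0 + M) :
    ∀ t ∈ Icc 0 τ, -gronwallBound (-x 0 0) (-(ε * Bh + σ * ch + L)) (-(μ * cℓ ^ 2 - M - δ)) t ≤
      x t 0 := by
  choose! V hV hVδ using h.defect
  have hcn : ContinuousOn (fun s => x s 0) (Icc 0 τ) :=
    (continuous_apply 0).comp_continuousOn h.continuousOn
  have hdv : ∀ s ∈ Ico 0 τ, HasDerivWithinAt (fun s => x s 0) (V s 0) (Ici s) s :=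
    fun s hs => (hasDerivWithinAt_pi.1 (hV s hs)) 0
  have hbd : ∀ s ∈ Ico 0 τ,
      -(ε * Bh + σ * ch + L) * x s 0 - -(μ * cℓ ^ 2 - M - δ) ≤ V s 0 := by
    intro s hs
    have hg := abs_apply_le_of_norm_le (hVδ s hs) 0
    rw [Pi.sub_apply, thresholdCircuit_apply_zero] at hg
    have h1 := (abs_le.1 hg).1
    have ha0 := ha s hs; obtain ⟨hb0, hbB⟩ := hb s hs; obtain ⟨hcC, hcC'⟩ := hc s hs
    have e1 : ε * x s 0 * x s 1 ≤ ε * Bh * x s 0 := by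
      have := mul_le_mul_of_nonneg_left hbB (mul_nonneg hε ha0); linarith [this]
    have e2 : σ * x s 0 * x s 2 ≤ σ * ch * x s 0 := by
      have := mul_le_mul_of_nonneg_left hcC' (mul_nonneg hσ ha0); linarith [this]
    have e3 : μ * cℓ ^ 2 ≤ μ * x s 2 ^ 2 :=
      mul_le_mul_of_nonneg_left (pow_le_pow_left₀ hcℓ hcC 2) hμ
    have e4 := hrot s hs
    linarith
  intro t ht
  have := gronwallBound_neg_le_of_le_deriv_right hcn hdv hbd t ht
  simpa using this

/-- **Carrier ceiling.** While `a ≥ 0`, `b ≥ Bℓ ≥ 0`, `cℓ ≤ c ≤ ch` (`cℓ ≥ 0`) and the rotor term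
obeys `L'·a - M' ≤ r·d·c` on `[0, τ)`: `∂ₜa ≤ -(εBℓ + σcℓ + L')a + (μch² + M' + δ)`, hence
`a(t) ≤ gronwallBound(a(0), -(εBℓ + σcℓ + L'), μch² + M' + δ, t)`. [folklore] -/
theorem carrier_le_gronwall (h : IsForcedWindow ε σ ν μ r κ δ τ x) (hε : 0 ≤ ε) (hσ : 0 ≤ σ)
    (hμ : 0 ≤ μ) {Bℓ cℓ ch L' M' : ℝ} (hcℓ : 0 ≤ cℓ)
    (ha : ∀ t ∈ Ico 0 τ, 0 ≤ x t 0) (hb : ∀ t ∈ Ico 0 τ, Bℓ ≤ x t 1)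
    (hc : ∀ t ∈ Ico 0 τ, cℓ ≤ x t 2 ∧ x t 2 ≤ ch)
    (hrot : ∀ t ∈ Ico 0 τ, L' * x t 0 - M' ≤ r * x t 3 * x t 2) :
    ∀ t ∈ Icc 0 τ, x t 0 ≤
      gronwallBound (x 0 0) (-(ε * Bℓ + σ * cℓ + L')) (μ * ch ^ 2 + M' + δ) t := by
  choose! V hV hVδ using h.defect
  have hcn : ContinuousOn (fun s => x s 0) (Icc 0 τ) :=
    (continuous_apply 0).comp_continuousOn h.continuousOn
  have hdv : ∀ s ∈ Ico 0 τ, HasDerivWithinAt (fun s => x s 0) (V s 0) (Ici s) s :=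
    fun s hs => (hasDerivWithinAt_pi.1 (hV s hs)) 0
  have hbd : ∀ s ∈ Ico 0 τ,
      V s 0 ≤ -(ε * Bℓ + σ * cℓ + L') * x s 0 + (μ * ch ^ 2 + M' + δ) := by
    intro s hs
    have hg := abs_apply_le_of_norm_le (hVδ s hs) 0
    rw [Pi.sub_apply, thresholdCircuit_apply_zero] at hg
    have h1 := (abs_le.1 hg).2
    have ha0 := ha s hs; have hbB := hb s hs; obtain ⟨hcC, hcC'⟩ := hc s hs
    have hc0 : 0 ≤ x s 2 := hcℓ.trans hcC
    have e1 : ε * Bℓ * x s 0 ≤ ε * x s 0 * x s 1 := by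
      have := mul_le_mul_of_nonneg_left hbB (mul_nonneg hε ha0); linarith [this]
    have e2 : σ * cℓ * x s 0 ≤ σ * x s 0 * x s 2 := by
      have := mul_le_mul_of_nonneg_left hcC (mul_nonneg hσ ha0); linarith [this]
    have e3 : μ * x s 2 ^ 2 ≤ μ * ch ^ 2 :=
      mul_le_mul_of_nonneg_left (pow_le_pow_left₀ hc0 hcC' 2) hμ
    have e4 := hrot s hs
    linarith
  intro t ht
  have := le_gronwallBound_of_deriv_right_le hcn hdv hbd t ht
  simpa using this

/-- **Rotor ceiling from the residual ceiling** (pointwise algebra): if `κdã - rca ≤ Wh`,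
`ã ≥ Zℓ > 0`, `ã ≤ Zh`, `cℓ ≤ c ≤ ch`, `cℓ ≥ 0`, `a ≥ 0`, `κ > 0`, `r ≥ 0`, then
`r·d·c ≤ (r²ch²/(κZℓ))·a + (r·ch·max(Wh,0)/(κZℓ) - r·cℓ·max(-Wh,0)/(κZh))`. [folklore] -/
theorem rotor_le_of_slavingResidual (hr : 0 ≤ r) (hκ : 0 < κ) {cℓ ch Zℓ Zh Wh : ℝ}
    (hcℓ : 0 ≤ cℓ) (hZℓ : 0 < Zℓ) {X : Fin 5 → ℝ} (ha : 0 ≤ X 0) (hc : cℓ ≤ X 2 ∧ X 2 ≤ ch)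
    (hz : Zℓ ≤ X 4 ∧ X 4 ≤ Zh) (hw : slavingResidual κ r X ≤ Wh) :
    r * X 3 * X 2 ≤ r ^ 2 * ch ^ 2 / (κ * Zℓ) * X 0 +
      (r * ch * max Wh 0 / (κ * Zℓ) - r * cℓ * max (-Wh) 0 / (κ * Zh)) := by
  simp only [slavingResidual_apply] at hw
  have hz0 : 0 < X 4 := hZℓ.trans_le hz.1
  have hκz : 0 < κ * X 4 := mul_pos hκ hz0
  have hκZℓ : 0 < κ * Zℓ := mul_pos hκ hZℓ
  have hκZh : 0 < κ * Zh := mul_pos hκ (hz0.trans_le hz.2)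
  have hc0 : 0 ≤ X 2 := hcℓ.trans hc.1
  -- d ≤ (Wh + r c a)/(κ ã)
  have hd : X 3 ≤ (Wh + r * X 2 * X 0) / (κ * X 4) := by
    rw [le_div_iff₀ hκz]; linarith
  have hrc : 0 ≤ r * X 2 := mul_nonneg hr hc0
  have h1 : r * X 3 * X 2 ≤ r * X 2 * ((Wh + r * X 2 * X 0) / (κ * X 4)) := by
    have := mul_le_mul_of_nonneg_left hd hrc; linarith [this]
  -- split the right-hand side
  have h2 : r * X 2 * ((Wh + r * X 2 * X 0) / (κ * X 4)) =
      r ^ 2 * X 2 ^ 2 * X 0 / (κ * X 4) + r * X 2 * Wh / (κ * X 4) := by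
    field_simp; ring
  have h3 : r ^ 2 * X 2 ^ 2 * X 0 / (κ * X 4) ≤ r ^ 2 * ch ^ 2 / (κ * Zℓ) * X 0 := by
    rw [div_mul_eq_mul_div, div_le_div_iff₀ hκz hκZℓ]
    have e1 : X 2 ^ 2 ≤ ch ^ 2 := pow_le_pow_left₀ hc0 hc.2 2
    have e2 : r ^ 2 * X 2 ^ 2 * X 0 ≤ r ^ 2 * ch ^ 2 * X 0 :=
      mul_le_mul_of_nonneg_right (mul_le_mul_of_nonneg_left e1 (pow_nonneg hr 2)) ha
    have e3 : κ * Zℓ ≤ κ * X 4 := mul_le_mul_of_nonneg_left hz.1 hκ.le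
    calc r ^ 2 * X 2 ^ 2 * X 0 * (κ * Zℓ) ≤ r ^ 2 * ch ^ 2 * X 0 * (κ * Zℓ) :=
          mul_le_mul_of_nonneg_right e2 hκZℓ.le
      _ ≤ r ^ 2 * ch ^ 2 * X 0 * (κ * X 4) :=
          mul_le_mul_of_nonneg_left e3 (by positivity)
  have h4 : r * X 2 * Wh / (κ * X 4) ≤
      r * ch * max Wh 0 / (κ * Zℓ) - r * cℓ * max (-Wh) 0 / (κ * Zh) := by
    rcases le_or_gt 0 Wh with hW | hW
    · rw [max_eq_left hW, max_eq_right (by linarith : -Wh ≤ 0), mul_zero, zero_div, sub_zero,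
        div_le_div_iff₀ hκz hκZℓ]
      have e1 : r * X 2 * Wh ≤ r * ch * Wh :=
        mul_le_mul_of_nonneg_right (mul_le_mul_of_nonneg_left hc.2 hr) hW
      have e3 : κ * Zℓ ≤ κ * X 4 := mul_le_mul_of_nonneg_left hz.1 hκ.le
      calc r * X 2 * Wh * (κ * Zℓ) ≤ r * ch * Wh * (κ * Zℓ) :=
            mul_le_mul_of_nonneg_right e1 hκZℓ.le
        _ ≤ r * ch * Wh * (κ * X 4) :=
            mul_le_mul_of_nonneg_left e3 (by nlinarith [mul_nonneg hr (hc0.trans hc.2)])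
    · rw [max_eq_right hW.le, max_eq_left (by linarith : 0 ≤ -Wh), mul_zero, zero_div, zero_sub,
        le_neg, ← neg_div, div_le_div_iff₀ hκZh hκz]
      have e1 : r * cℓ * -Wh ≤ r * X 2 * -Wh :=
        mul_le_mul_of_nonneg_right (mul_le_mul_of_nonneg_left hc.1 hr) (by linarith)
      have e3 : κ * X 4 ≤ κ * Zh := mul_le_mul_of_nonneg_left hz.2 hκ.le
      have : r * cℓ * -Wh * (κ * X 4) ≤ r * X 2 * -Wh * (κ * Zh) :=
        mul_le_mul e1 e3 hκz.le (by nlinarith [mul_nonneg hr hc0])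
      linarith
  linarith [h1, h2, h3, h4]

/-- **Rotor floor from the residual floor** (pointwise algebra): if `Wℓ ≤ κdã - rca`,
`ã ≥ Zℓ > 0`, `ã ≤ Zh`, `cℓ ≤ c ≤ ch`, `cℓ ≥ 0`, `a ≥ 0`, then
`(r²cℓ²/(κZh))·a - (r·ch·max(-Wℓ,0)/(κZℓ) - r·cℓ·max(Wℓ,0)/(κZh)) ≤ r·d·c`. [folklore] -/
theorem rotor_ge_of_slavingResidual (hr : 0 ≤ r) (hκ : 0 < κ) {cℓ ch Zℓ Zh Wℓ : ℝ}
    (hcℓ : 0 ≤ cℓ) (hZℓ : 0 < Zℓ) {X : Fin 5 → ℝ} (ha : 0 ≤ X 0) (hc : cℓ ≤ X 2 ∧ X 2 ≤ ch)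
    (hz : Zℓ ≤ X 4 ∧ X 4 ≤ Zh) (hw : Wℓ ≤ slavingResidual κ r X) :
    r ^ 2 * cℓ ^ 2 / (κ * Zh) * X 0 -
        (r * ch * max (-Wℓ) 0 / (κ * Zℓ) - r * cℓ * max Wℓ 0 / (κ * Zh)) ≤ r * X 3 * X 2 := by
  simp only [slavingResidual_apply] at hw
  have hz0 : 0 < X 4 := hZℓ.trans_le hz.1
  have hκz : 0 < κ * X 4 := mul_pos hκ hz0
  have hκZℓ : 0 < κ * Zℓ := mul_pos hκ hZℓ
  have hκZh : 0 < κ * Zh := mul_pos hκ (hz0.trans_le hz.2)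
  have hc0 : 0 ≤ X 2 := hcℓ.trans hc.1
  have hd : (Wℓ + r * X 2 * X 0) / (κ * X 4) ≤ X 3 := by
    rw [div_le_iff₀ hκz]; linarith
  have hrc : 0 ≤ r * X 2 := mul_nonneg hr hc0
  have h1 : r * X 2 * ((Wℓ + r * X 2 * X 0) / (κ * X 4)) ≤ r * X 3 * X 2 := by
    have := mul_le_mul_of_nonneg_left hd hrc; linarith [this]
  have h2 : r * X 2 * ((Wℓ + r * X 2 * X 0) / (κ * X 4)) =
      r ^ 2 * X 2 ^ 2 * X 0 / (κ * X 4) + r * X 2 * Wℓ / (κ * X 4) := by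
    field_simp; ring
  have h3 : r ^ 2 * cℓ ^ 2 / (κ * Zh) * X 0 ≤ r ^ 2 * X 2 ^ 2 * X 0 / (κ * X 4) := by
    rw [div_mul_eq_mul_div, div_le_div_iff₀ hκZh hκz]
    have e1 : cℓ ^ 2 ≤ X 2 ^ 2 := pow_le_pow_left₀ hcℓ hc.1 2
    have e2 : r ^ 2 * cℓ ^ 2 * X 0 ≤ r ^ 2 * X 2 ^ 2 * X 0 :=
      mul_le_mul_of_nonneg_right (mul_le_mul_of_nonneg_left e1 (pow_nonneg hr 2)) ha
    have e3 : κ * X 4 ≤ κ * Zh := mul_le_mul_of_nonneg_left hz.2 hκ.le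
    exact mul_le_mul e2 e3 hκz.le (by positivity)
  have h4 : -(r * ch * max (-Wℓ) 0 / (κ * Zℓ) - r * cℓ * max Wℓ 0 / (κ * Zh)) ≤
      r * X 2 * Wℓ / (κ * X 4) := by
    rcases le_or_gt 0 Wℓ with hW | hW
    · rw [max_eq_left hW, max_eq_right (by linarith : -Wℓ ≤ 0), mul_zero, zero_div, zero_sub,
        neg_neg, div_le_div_iff₀ hκZh hκz]
      have e1 : r * cℓ * Wℓ ≤ r * X 2 * Wℓ :=
        mul_le_mul_of_nonneg_right (mul_le_mul_of_nonneg_left hc.1 hr) hW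
      have e3 : κ * X 4 ≤ κ * Zh := mul_le_mul_of_nonneg_left hz.2 hκ.le
      exact mul_le_mul e1 e3 hκz.le (by nlinarith [mul_nonneg hr hc0])
    · rw [max_eq_right hW.le, max_eq_left (by linarith : 0 ≤ -Wℓ), mul_zero, zero_div, sub_zero,
        neg_le, ← neg_div, div_le_div_iff₀ hκz hκZℓ]
      have e1 : r * X 2 * -Wℓ ≤ r * ch * -Wℓ :=
        mul_le_mul_of_nonneg_right (mul_le_mul_of_nonneg_left hc.2 hr) (by linarith)
      have e3 : κ * Zℓ ≤ κ * X 4 := mul_le_mul_of_nonneg_left hz.1 hκ.le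
      have : r * X 2 * -Wℓ * (κ * Zℓ) ≤ r * ch * -Wℓ * (κ * X 4) :=
        mul_le_mul e1 e3 hκZℓ.le (by nlinarith [mul_nonneg hr (hc0.trans hc.2)])
      linarith
  linarith [h1, h2, h3, h4]

/-- **Conduit box from the residual box** (pointwise algebra): with `κ > 0`, `0 < Zℓ ≤ ã ≤ Zh`,
`cℓ ≤ c ≤ ch`, `0 ≤ Aℓ ≤ a ≤ Ah`, `r ≥ 0`, `cℓ ≥ 0` and `Wℓ ≤ κdã - rca ≤ Wh`:
`min((Wℓ + r cℓ Aℓ)/(κZh), (Wℓ + r cℓ Aℓ)/(κZℓ)) ≤ d ≤ max((Wh + r ch Ah)/(κZℓ), (Wh + r ch Ah)/(κZh))`.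
[folklore] -/
theorem conduit_bounds_of_slavingResidual (hr : 0 ≤ r) (hκ : 0 < κ) {Aℓ Ah cℓ ch Zℓ Zh Wℓ Wh : ℝ}
    (hAℓ : 0 ≤ Aℓ) (hcℓ : 0 ≤ cℓ) (hZℓ : 0 < Zℓ) {X : Fin 5 → ℝ} (ha : Aℓ ≤ X 0 ∧ X 0 ≤ Ah)
    (hc : cℓ ≤ X 2 ∧ X 2 ≤ ch) (hz : Zℓ ≤ X 4 ∧ X 4 ≤ Zh)
    (hw : Wℓ ≤ slavingResidual κ r X ∧ slavingResidual κ r X ≤ Wh) :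
    min ((Wℓ + r * cℓ * Aℓ) / (κ * Zh)) ((Wℓ + r * cℓ * Aℓ) / (κ * Zℓ)) ≤ X 3 ∧
      X 3 ≤ max ((Wh + r * ch * Ah) / (κ * Zℓ)) ((Wh + r * ch * Ah) / (κ * Zh)) := by
  simp only [slavingResidual_apply] at hw
  have hz0 : 0 < X 4 := hZℓ.trans_le hz.1
  have hκz : 0 < κ * X 4 := mul_pos hκ hz0
  have hκZℓ : 0 < κ * Zℓ := mul_pos hκ hZℓ
  have hκZh : 0 < κ * Zh := mul_pos hκ (hz0.trans_le hz.2)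
  have ha0 : 0 ≤ X 0 := hAℓ.trans ha.1
  have hc0 : 0 ≤ X 2 := hcℓ.trans hc.1
  have hrca_lo : r * cℓ * Aℓ ≤ r * X 2 * X 0 :=
    mul_le_mul (mul_le_mul_of_nonneg_left hc.1 hr) ha.1 hAℓ (mul_nonneg hr hc0)
  have hrca_hi : r * X 2 * X 0 ≤ r * ch * Ah :=
    mul_le_mul (mul_le_mul_of_nonneg_left hc.2 hr) ha.2 ha0 (mul_nonneg hr (hc0.trans hc.2))
  have hlo : Wℓ + r * cℓ * Aℓ ≤ κ * X 4 * X 3 := by nlinarith [hw.1]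
  have hhi : κ * X 4 * X 3 ≤ Wh + r * ch * Ah := by nlinarith [hw.2]
  constructor
  · rcases le_or_gt 0 (Wℓ + r * cℓ * Aℓ) with hs | hs
    · refine (min_le_left _ _).trans ?_
      rw [div_le_iff₀ hκZh]
      calc Wℓ + r * cℓ * Aℓ ≤ κ * X 4 * X 3 := hlo
        _ ≤ X 3 * (κ * Zh) := by
            have hd0 : 0 ≤ X 3 := by
              by_contra hneg; push Not at hneg
              have : κ * X 4 * X 3 < 0 := mul_neg_of_pos_of_neg hκz hneg
              linarith
            nlinarith [mul_le_mul_of_nonneg_left hz.2 hκ.le]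
    · refine (min_le_right _ _).trans ?_
      rw [div_le_iff₀ hκZℓ]
      rcases le_or_gt 0 (X 3) with hd0 | hd0
      · nlinarith [mul_nonneg hκZℓ.le hd0]
      · calc Wℓ + r * cℓ * Aℓ ≤ κ * X 4 * X 3 := hlo
          _ ≤ X 3 * (κ * Zℓ) := by nlinarith [mul_le_mul_of_nonneg_left hz.1 hκ.le]
  · rcases le_or_gt 0 (Wh + r * ch * Ah) with hs | hs
    · refine le_trans ?_ (le_max_left _ _)
      rw [le_div_iff₀ hκZℓ]
      rcases le_or_gt 0 (X 3) with hd0 | hd0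
      · calc X 3 * (κ * Zℓ) ≤ κ * X 4 * X 3 := by nlinarith [mul_le_mul_of_nonneg_left hz.1 hκ.le]
          _ ≤ Wh + r * ch * Ah := hhi
      · nlinarith [mul_pos hκZℓ (neg_pos.2 hd0)]
    · refine le_trans ?_ (le_max_right _ _)
      rw [le_div_iff₀ hκZh]
      have hd0 : X 3 < 0 := by
        by_contra hnn; push Not at hnn
        have : 0 ≤ κ * X 4 * X 3 := mul_nonneg hκz.le hnn
        linarith
      calc X 3 * (κ * Zh) ≤ κ * X 4 * X 3 := by nlinarith [mul_le_mul_of_nonneg_left hz.2 hκ.le]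
        _ ≤ Wh + r * ch * Ah := hhi

/-! ### Trigger, clock, output, conduit: affine two-sided bounds from a box -/

/-- **Trigger floor, linear**: while `a ≥ Aℓ ≥ 0`, `c ≥ cℓ ≥ 0` and the net rate is `≥ gℓ ≥ 0`:
`c(t) ≥ c(0) + (σAℓ² + gℓcℓ - δ)t`. [folklore] -/
theorem trigger_ge_lin (h : IsForcedWindow ε σ ν μ r κ δ τ x) (hσ : 0 ≤ σ) {Aℓ cℓ gℓ : ℝ}
    (hAℓ : 0 ≤ Aℓ) (hcℓ : 0 ≤ cℓ) (hgℓ : 0 ≤ gℓ)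
    (ha : ∀ t ∈ Ico 0 τ, Aℓ ≤ x t 0) (hc : ∀ t ∈ Ico 0 τ, cℓ ≤ x t 2)
    (hg : ∀ t ∈ Ico 0 τ, gℓ ≤ ν * x t 1 - μ * x t 0) :
    ∀ t ∈ Icc 0 τ, x 0 2 + (σ * Aℓ ^ 2 + gℓ * cℓ - δ) * t ≤ x t 2 := by
  choose! V hV hVδ using h.defect
  have hcn : ContinuousOn (fun s => x s 2) (Icc 0 τ) :=
    (continuous_apply 2).comp_continuousOn h.continuousOn
  have hdv : ∀ s ∈ Ico 0 τ, HasDerivWithinAt (fun s => x s 2) (V s 2) (Ici s) s :=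
    fun s hs => (hasDerivWithinAt_pi.1 (hV s hs)) 2
  have hbd : ∀ s ∈ Ico 0 τ, σ * Aℓ ^ 2 + gℓ * cℓ - δ ≤ V s 2 := by
    intro s hs
    have hgs := abs_apply_le_of_norm_le (hVδ s hs) 2
    rw [Pi.sub_apply, thresholdCircuit_apply_two] at hgs
    have h1 := (abs_le.1 hgs).1
    have e1 : σ * Aℓ ^ 2 ≤ σ * x s 0 ^ 2 :=
      mul_le_mul_of_nonneg_left (pow_le_pow_left₀ hAℓ (ha s hs) 2) hσ
    have e2 : gℓ * cℓ ≤ (ν * x s 1 - μ * x s 0) * x s 2 :=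
      mul_le_mul (hg s hs) (hc s hs) hcℓ (hgℓ.trans (hg s hs))
    nlinarith
  intro t ht
  have := mul_le_sub_of_le_deriv_right hcn hdv hbd t ht
  simp only [sub_zero] at this
  linarith

/-- **Trigger ceiling, linear**: while `0 ≤ a ≤ Ah`, `0 ≤ c ≤ ch` and the net rate is `≤ gh` with
`gh ≥ 0`: `c(t) ≤ c(0) + (σAh² + gh·ch + δ)t`. [folklore] -/
theorem trigger_le_lin (h : IsForcedWindow ε σ ν μ r κ δ τ x) (hσ : 0 ≤ σ) {Ah ch gh : ℝ}
    (hgh : 0 ≤ gh)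
    (ha : ∀ t ∈ Ico 0 τ, 0 ≤ x t 0 ∧ x t 0 ≤ Ah) (hc : ∀ t ∈ Ico 0 τ, 0 ≤ x t 2 ∧ x t 2 ≤ ch)
    (hg : ∀ t ∈ Ico 0 τ, ν * x t 1 - μ * x t 0 ≤ gh) :
    ∀ t ∈ Icc 0 τ, x t 2 ≤ x 0 2 + (σ * Ah ^ 2 + gh * ch + δ) * t := by
  choose! V hV hVδ using h.defect
  have hcn : ContinuousOn (fun s => x s 2) (Icc 0 τ) :=
    (continuous_apply 2).comp_continuousOn h.continuousOn
  have hdv : ∀ s ∈ Ico 0 τ, HasDerivWithinAt (fun s => x s 2) (V s 2) (Ici s) s :=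
    fun s hs => (hasDerivWithinAt_pi.1 (hV s hs)) 2
  have hbd : ∀ s ∈ Ico 0 τ, V s 2 ≤ σ * Ah ^ 2 + gh * ch + δ := by
    intro s hs
    have hgs := abs_apply_le_of_norm_le (hVδ s hs) 2
    rw [Pi.sub_apply, thresholdCircuit_apply_two] at hgs
    have h1 := (abs_le.1 hgs).2
    obtain ⟨ha0, haA⟩ := ha s hs; obtain ⟨hc0, hcC⟩ := hc s hs
    have e1 : σ * x s 0 ^ 2 ≤ σ * Ah ^ 2 :=
      mul_le_mul_of_nonneg_left (pow_le_pow_left₀ ha0 haA 2) hσ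
    have e2 : (ν * x s 1 - μ * x s 0) * x s 2 ≤ gh * ch := by
      rcases le_or_gt 0 (ν * x s 1 - μ * x s 0) with hg0 | hg0
      · exact mul_le_mul (hg s hs) hcC hc0 hgh
      · have : (ν * x s 1 - μ * x s 0) * x s 2 ≤ 0 := mul_nonpos_of_nonpos_of_nonneg hg0.le hc0
        exact this.trans (mul_nonneg hgh (hc0.trans hcC))
    nlinarith
  intro t ht
  have := sub_le_mul_of_deriv_right_le hcn hdv hbd t ht
  simp only [sub_zero] at this
  linarith

/-- **Clock, two-sided linear**: while `Aℓ ≤ a ≤ Ah` (`Aℓ ≥ 0`) and `cℓ ≤ c ≤ ch` (`cℓ ≥ 0`):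
`b(0) + (εAℓ² - νch² - δ)t ≤ b(t) ≤ b(0) + (εAh² - νcℓ² + δ)t`. [folklore] -/
theorem clock_two_sided_lin (h : IsForcedWindow ε σ ν μ r κ δ τ x) (hε : 0 ≤ ε) (hν : 0 ≤ ν)
    {Aℓ Ah cℓ ch : ℝ} (hAℓ : 0 ≤ Aℓ) (hcℓ : 0 ≤ cℓ)
    (ha : ∀ t ∈ Ico 0 τ, Aℓ ≤ x t 0 ∧ x t 0 ≤ Ah) (hc : ∀ t ∈ Ico 0 τ, cℓ ≤ x t 2 ∧ x t 2 ≤ ch) :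
    ∀ t ∈ Icc 0 τ, x 0 1 + (ε * Aℓ ^ 2 - ν * ch ^ 2 - δ) * t ≤ x t 1 ∧
      x t 1 ≤ x 0 1 + (ε * Ah ^ 2 - ν * cℓ ^ 2 + δ) * t := by
  choose! V hV hVδ using h.defect
  have hcn : ContinuousOn (fun s => x s 1) (Icc 0 τ) :=
    (continuous_apply 1).comp_continuousOn h.continuousOn
  have hdv : ∀ s ∈ Ico 0 τ, HasDerivWithinAt (fun s => x s 1) (V s 1) (Ici s) s :=
    fun s hs => (hasDerivWithinAt_pi.1 (hV s hs)) 1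
  have hbd : ∀ s ∈ Ico 0 τ, ε * Aℓ ^ 2 - ν * ch ^ 2 - δ ≤ V s 1 ∧
      V s 1 ≤ ε * Ah ^ 2 - ν * cℓ ^ 2 + δ := by
    intro s hs
    have hgs := abs_apply_le_of_norm_le (hVδ s hs) 1
    rw [Pi.sub_apply, thresholdCircuit_apply_one] at hgs
    have h1 := abs_le.1 hgs
    obtain ⟨haA, haA'⟩ := ha s hs; obtain ⟨hcC, hcC'⟩ := hc s hs
    have ha0 : 0 ≤ x s 0 := hAℓ.trans haA
    have hc0 : 0 ≤ x s 2 := hcℓ.trans hcC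
    have e1 : ε * Aℓ ^ 2 ≤ ε * x s 0 ^ 2 :=
      mul_le_mul_of_nonneg_left (pow_le_pow_left₀ hAℓ haA 2) hε
    have e2 : ε * x s 0 ^ 2 ≤ ε * Ah ^ 2 :=
      mul_le_mul_of_nonneg_left (pow_le_pow_left₀ ha0 haA' 2) hε
    have e3 : ν * cℓ ^ 2 ≤ ν * x s 2 ^ 2 :=
      mul_le_mul_of_nonneg_left (pow_le_pow_left₀ hcℓ hcC 2) hν
    have e4 : ν * x s 2 ^ 2 ≤ ν * ch ^ 2 :=
      mul_le_mul_of_nonneg_left (pow_le_pow_left₀ hc0 hcC' 2) hν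
    constructor <;> linarith [h1.1, h1.2]
  intro t ht
  have h1 := mul_le_sub_of_le_deriv_right hcn hdv (fun s hs => (hbd s hs).1) t ht
  have h2 := sub_le_mul_of_deriv_right_le hcn hdv (fun s hs => (hbd s hs).2) t ht
  simp only [sub_zero] at h1 h2
  constructor <;> linarith

/-- **Output, two-sided linear**: while `Dℓ ≤ d ≤ Dh` (`Dℓ ≥ 0`):
`ã(0) + (κDℓ² - δ)t ≤ ã(t) ≤ ã(0) + (κDh² + δ)t`. [folklore] -/
theorem output_two_sided_lin (h : IsForcedWindow ε σ ν μ r κ δ τ x) (hκ : 0 ≤ κ) {Dℓ Dh : ℝ}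
    (hDℓ : 0 ≤ Dℓ) (hd : ∀ t ∈ Ico 0 τ, Dℓ ≤ x t 3 ∧ x t 3 ≤ Dh) :
    ∀ t ∈ Icc 0 τ, x 0 4 + (κ * Dℓ ^ 2 - δ) * t ≤ x t 4 ∧
      x t 4 ≤ x 0 4 + (κ * Dh ^ 2 + δ) * t := by
  choose! V hV hVδ using h.defect
  have hcn : ContinuousOn (fun s => x s 4) (Icc 0 τ) :=
    (continuous_apply 4).comp_continuousOn h.continuousOn
  have hdv : ∀ s ∈ Ico 0 τ, HasDerivWithinAt (fun s => x s 4) (V s 4) (Ici s) s :=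
    fun s hs => (hasDerivWithinAt_pi.1 (hV s hs)) 4
  have hbd : ∀ s ∈ Ico 0 τ, κ * Dℓ ^ 2 - δ ≤ V s 4 ∧ V s 4 ≤ κ * Dh ^ 2 + δ := by
    intro s hs
    have hgs := abs_apply_le_of_norm_le (hVδ s hs) 4
    rw [Pi.sub_apply, thresholdCircuit_apply_four] at hgs
    have h1 := abs_le.1 hgs
    obtain ⟨hdD, hdD'⟩ := hd s hs
    have e1 : κ * Dℓ ^ 2 ≤ κ * x s 3 ^ 2 :=
      mul_le_mul_of_nonneg_left (pow_le_pow_left₀ hDℓ hdD 2) hκ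
    have e2 : κ * x s 3 ^ 2 ≤ κ * Dh ^ 2 :=
      mul_le_mul_of_nonneg_left (pow_le_pow_left₀ (hDℓ.trans hdD) hdD' 2) hκ
    constructor <;> linarith [h1.1, h1.2]
  intro t ht
  have h1 := mul_le_sub_of_le_deriv_right hcn hdv (fun s hs => (hbd s hs).1) t ht
  have h2 := sub_le_mul_of_deriv_right_le hcn hdv (fun s hs => (hbd s hs).2) t ht
  simp only [sub_zero] at h1 h2
  constructor <;> linarith

/-! ### The crude (ball-only) bounds of the first pass -/

/-- **Crude carrier floor**: while `|a|, |b| ≤ R`, `a ≥ 0`, `0 ≤ c ≤ Ch` and `d ≤ Dh`: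
`a(t) ≥ a(0) - (εR² + σR·Ch + r·Ch·max(Dh,0) + δ)t`. [folklore] -/
theorem carrier_ge_crude (h : IsForcedWindow ε σ ν μ r κ δ τ x) (hε : 0 ≤ ε) (hσ : 0 ≤ σ)
    (hμ : 0 ≤ μ) (hr : 0 ≤ r) {R Ch Dh : ℝ} (hR : ∀ t ∈ Ico 0 τ, ∀ i, |x t i| ≤ R)
    (ha : ∀ t ∈ Ico 0 τ, 0 ≤ x t 0) (hc : ∀ t ∈ Ico 0 τ, 0 ≤ x t 2 ∧ x t 2 ≤ Ch)
    (hd : ∀ t ∈ Ico 0 τ, x t 3 ≤ Dh) :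
    ∀ t ∈ Icc 0 τ, x 0 0 - (ε * R ^ 2 + σ * R * Ch + r * Ch * max Dh 0 + δ) * t ≤ x t 0 := by
  choose! V hV hVδ using h.defect
  have hcn : ContinuousOn (fun s => x s 0) (Icc 0 τ) :=
    (continuous_apply 0).comp_continuousOn h.continuousOn
  have hdv : ∀ s ∈ Ico 0 τ, HasDerivWithinAt (fun s => x s 0) (V s 0) (Ici s) s :=
    fun s hs => (hasDerivWithinAt_pi.1 (hV s hs)) 0
  have hbd : ∀ s ∈ Ico 0 τ, -(ε * R ^ 2 + σ * R * Ch + r * Ch * max Dh 0 + δ) ≤ V s 0 := by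
    intro s hs
    have hgs := abs_apply_le_of_norm_le (hVδ s hs) 0
    rw [Pi.sub_apply, thresholdCircuit_apply_zero] at hgs
    have h1 := (abs_le.1 hgs).1
    have ha0 := ha s hs; obtain ⟨hc0, hcC⟩ := hc s hs
    have hRa := hR s hs 0; have hRb := hR s hs 1
    have hR0 : 0 ≤ R := (abs_nonneg _).trans hRa
    have e1 : ε * x s 0 * x s 1 ≤ ε * R ^ 2 := by
      have : x s 0 * x s 1 ≤ R ^ 2 := by
        calc x s 0 * x s 1 ≤ |x s 0 * x s 1| := le_abs_self _
          _ = |x s 0| * |x s 1| := abs_mul _ _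
          _ ≤ R * R := mul_le_mul hRa hRb (abs_nonneg _) hR0
          _ = R ^ 2 := (sq R).symm
      have := mul_le_mul_of_nonneg_left this hε; linarith
    have e2 : σ * x s 0 * x s 2 ≤ σ * R * Ch := by
      have haR : x s 0 ≤ R := (le_abs_self _).trans hRa
      have : x s 0 * x s 2 ≤ R * Ch := mul_le_mul haR hcC hc0 hR0
      have := mul_le_mul_of_nonneg_left this hσ; linarith
    have e3 : r * x s 3 * x s 2 ≤ r * Ch * max Dh 0 := by
      have : x s 3 * x s 2 ≤ max Dh 0 * Ch :=
        mul_le_mul ((hd s hs).trans (le_max_left _ _)) hcC hc0 (le_max_right _ _)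
      have := mul_le_mul_of_nonneg_left this hr; linarith
    have e4 : 0 ≤ μ * x s 2 ^ 2 := by positivity
    linarith
  intro t ht
  have := mul_le_sub_of_le_deriv_right hcn hdv hbd t ht
  simp only [sub_zero] at this
  linarith

/-- **Crude conduit ceiling**: while `0 ≤ a ≤ Ah`, `0 ≤ c ≤ Ch`, `d ≥ 0`, `ã ≥ 0`:
`d(t) ≤ d(0) + (r·Ah·Ch + δ)t`. [folklore] -/
theorem conduit_le_lin (h : IsForcedWindow ε σ ν μ r κ δ τ x) (hr : 0 ≤ r) (hκ : 0 ≤ κ)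
    {Ah Ch : ℝ} (ha : ∀ t ∈ Ico 0 τ, 0 ≤ x t 0 ∧ x t 0 ≤ Ah)
    (hc : ∀ t ∈ Ico 0 τ, 0 ≤ x t 2 ∧ x t 2 ≤ Ch) (hd : ∀ t ∈ Ico 0 τ, 0 ≤ x t 3)
    (hz : ∀ t ∈ Ico 0 τ, 0 ≤ x t 4) :
    ∀ t ∈ Icc 0 τ, x t 3 ≤ x 0 3 + (r * Ah * Ch + δ) * t := by
  choose! V hV hVδ using h.defect
  have hcn : ContinuousOn (fun s => x s 3) (Icc 0 τ) :=
    (continuous_apply 3).comp_continuousOn h.continuousOn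
  have hdv : ∀ s ∈ Ico 0 τ, HasDerivWithinAt (fun s => x s 3) (V s 3) (Ici s) s :=
    fun s hs => (hasDerivWithinAt_pi.1 (hV s hs)) 3
  have hbd : ∀ s ∈ Ico 0 τ, V s 3 ≤ r * Ah * Ch + δ := by
    intro s hs
    have hgs := abs_apply_le_of_norm_le (hVδ s hs) 3
    rw [Pi.sub_apply, thresholdCircuit_apply_three] at hgs
    have h1 := (abs_le.1 hgs).2
    obtain ⟨ha0, haA⟩ := ha s hs; obtain ⟨hc0, hcC⟩ := hc s hs
    have e1 : r * x s 0 * x s 2 ≤ r * Ah * Ch := by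
      have : x s 0 * x s 2 ≤ Ah * Ch := mul_le_mul haA hcC hc0 (ha0.trans haA)
      have := mul_le_mul_of_nonneg_left this hr; linarith
    have e2 : 0 ≤ κ * x s 3 * x s 4 := by
      have := hd s hs; have := hz s hs; positivity
    linarith
  intro t ht
  have := sub_le_mul_of_deriv_right_le hcn hdv hbd t ht
  simp only [sub_zero] at this
  linarith

/-- **Crude conduit floor**: while `a, c ≥ 0`, `d ≥ 0` and `|ã| ≤ R`:
`∂ₜd ≥ -κR·d - δ`, hence `d(t) ≥ -gronwallBound(-d(0), -κR, δ, t) = d(0)e^{-κRt} - (δ/κR)(1 - e^{-κRt})`.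
[folklore] -/
theorem conduit_ge_gronwall (h : IsForcedWindow ε σ ν μ r κ δ τ x) (hr : 0 ≤ r) (hκ : 0 ≤ κ)
    {R : ℝ} (hR : ∀ t ∈ Ico 0 τ, |x t 4| ≤ R)
    (ha : ∀ t ∈ Ico 0 τ, 0 ≤ x t 0) (hc : ∀ t ∈ Ico 0 τ, 0 ≤ x t 2) (hd : ∀ t ∈ Ico 0 τ, 0 ≤ x t 3) :
    ∀ t ∈ Icc 0 τ, -gronwallBound (-x 0 3) (-(κ * R)) δ t ≤ x t 3 := by
  choose! V hV hVδ using h.defect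
  have hcn : ContinuousOn (fun s => x s 3) (Icc 0 τ) :=
    (continuous_apply 3).comp_continuousOn h.continuousOn
  have hdv : ∀ s ∈ Ico 0 τ, HasDerivWithinAt (fun s => x s 3) (V s 3) (Ici s) s :=
    fun s hs => (hasDerivWithinAt_pi.1 (hV s hs)) 3
  have hbd : ∀ s ∈ Ico 0 τ, -(κ * R) * x s 3 - δ ≤ V s 3 := by
    intro s hs
    have hgs := abs_apply_le_of_norm_le (hVδ s hs) 3
    rw [Pi.sub_apply, thresholdCircuit_apply_three] at hgs
    have h1 := (abs_le.1 hgs).1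
    have hd0 := hd s hs
    have e1 : 0 ≤ r * x s 0 * x s 2 := by
      have := ha s hs; have := hc s hs; positivity
    have e2 : κ * x s 3 * x s 4 ≤ κ * R * x s 3 := by
      have hz : x s 4 ≤ R := (le_abs_self _).trans (hR s hs)
      have := mul_le_mul_of_nonneg_left hz (mul_nonneg hκ hd0); linarith
    linarith
  intro t ht
  have := gronwallBound_neg_le_of_le_deriv_right hcn hdv hbd t ht
  simpa using this

/-- **Crude trigger floor**: while `c ≥ 0` and `|a|, |b| ≤ R`: `∂ₜc ≥ -(ν + μ)R·c - δ` (for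
`ν, μ ≥ 0`), hence `c(t) ≥ -gronwallBound(-c(0), -((ν + μ)R), δ, t)`. [folklore] -/
theorem trigger_ge_gronwall (h : IsForcedWindow ε σ ν μ r κ δ τ x) (hσ : 0 ≤ σ) (hν : 0 ≤ ν)
    (hμ : 0 ≤ μ) {R : ℝ} (hR : ∀ t ∈ Ico 0 τ, ∀ i, |x t i| ≤ R) (hc : ∀ t ∈ Ico 0 τ, 0 ≤ x t 2) :
    ∀ t ∈ Icc 0 τ, -gronwallBound (-x 0 2) (-((ν + μ) * R)) δ t ≤ x t 2 := by
  choose! V hV hVδ using h.defect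
  have hcn : ContinuousOn (fun s => x s 2) (Icc 0 τ) :=
    (continuous_apply 2).comp_continuousOn h.continuousOn
  have hdv : ∀ s ∈ Ico 0 τ, HasDerivWithinAt (fun s => x s 2) (V s 2) (Ici s) s :=
    fun s hs => (hasDerivWithinAt_pi.1 (hV s hs)) 2
  have hbd : ∀ s ∈ Ico 0 τ, -((ν + μ) * R) * x s 2 - δ ≤ V s 2 := by
    intro s hs
    have hgs := abs_apply_le_of_norm_le (hVδ s hs) 2
    rw [Pi.sub_apply, thresholdCircuit_apply_two] at hgs
    have h1 := (abs_le.1 hgs).1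
    have hc0 := hc s hs
    have hRa := hR s hs 0; have hRb := hR s hs 1
    have e0 : 0 ≤ σ * x s 0 ^ 2 := by positivity
    have e1 : -(ν * R) * x s 2 ≤ ν * x s 1 * x s 2 := by
      have hb : -R ≤ x s 1 := (abs_le.1 hRb).1
      have := mul_le_mul_of_nonneg_left hb (mul_nonneg hν hc0)
      nlinarith
    have e2 : μ * x s 0 * x s 2 ≤ μ * R * x s 2 := by
      have haR : x s 0 ≤ R := (le_abs_self _).trans hRa
      have := mul_le_mul_of_nonneg_left haR (mul_nonneg hμ hc0)
      nlinarith
    nlinarith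
  intro t ht
  have := gronwallBound_neg_le_of_le_deriv_right hcn hdv hbd t ht
  simpa using this

/-- **Crude conduit floor, closed form**: under the hypotheses of `conduit_ge_gronwall` and
`κ, R, δ ≥ 0`: `d(0)e^{-κRt} - δt ≤ d(t)`. [folklore] -/
theorem conduit_ge_crude (h : IsForcedWindow ε σ ν μ r κ δ τ x) (hr : 0 ≤ r) (hκ : 0 ≤ κ)
    (hδ : 0 ≤ δ) {R : ℝ} (hR0 : 0 ≤ R) (hR : ∀ t ∈ Ico 0 τ, |x t 4| ≤ R)
    (ha : ∀ t ∈ Ico 0 τ, 0 ≤ x t 0) (hc : ∀ t ∈ Ico 0 τ, 0 ≤ x t 2) (hd : ∀ t ∈ Ico 0 τ, 0 ≤ x t 3) :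
    ∀ t ∈ Icc 0 τ, x 0 3 * Real.exp (-(κ * R) * t) - δ * t ≤ x t 3 := fun t ht =>
  (exp_sub_lin_le_neg_gronwallBound t (mul_nonneg hκ hR0) hδ).trans
    (h.conduit_ge_gronwall hr hκ hR ha hc hd t ht)

/-- **Crude trigger floor, linear form**: under the hypotheses of `trigger_ge_gronwall`, with
`c(0), R, δ ≥ 0`: `c(0)(1 - (ν + μ)Rt) - δt ≤ c(t)`. [folklore] -/
theorem trigger_ge_crude (h : IsForcedWindow ε σ ν μ r κ δ τ x) (hσ : 0 ≤ σ) (hν : 0 ≤ ν)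
    (hμ : 0 ≤ μ) (hδ : 0 ≤ δ) {R : ℝ} (hR0 : 0 ≤ R) (hR : ∀ t ∈ Ico 0 τ, ∀ i, |x t i| ≤ R)
    (hc0 : 0 ≤ x 0 2) (hc : ∀ t ∈ Ico 0 τ, 0 ≤ x t 2) :
    ∀ t ∈ Icc 0 τ, x 0 2 * (1 - (ν + μ) * R * t) - δ * t ≤ x t 2 := fun t ht => by
  have h1 := h.trigger_ge_gronwall hσ hν hμ hR hc t ht
  have h2 := exp_sub_lin_le_neg_gronwallBound (x₀ := x 0 2) (δ' := δ) t
    (mul_nonneg (add_nonneg hν hμ) hR0) hδ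
  have h3 := lin_le_exp_decay (K := (ν + μ) * R) (t := t) hc0
  have h4 : x 0 2 * (1 - (ν + μ) * R * t) = x 0 2 * (1 - ((ν + μ) * R) * t) := by ring
  linarith

end IsForcedWindow

end Literature.Analysis.FluidPDE.FluidComputer

end
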